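import Mathlib
import Literature.MathematicalPhysics.StatisticalMechanics.LocalMatchingCompactness
import Literature.MathematicalPhysics.StatisticalMechanics.LennardJonesClusters

/-!
# Crux `DisclinationRation.FiveFoldRation` (stmt-AtomisticToContinuum-15799), line `Sketch` —
# stub `stub_dr5_cubic`: Packing bound

A `δ`-separated `S ⊆ ℝ³` meets every closed ball in a finite set of at most `C₀ (1 + r)³` points,
`C₀` depending on `δ` only.

Proof: finiteness of `S ∩ B̄_r(c)` is the tree's
`finite_of_forall_le_dist_of_subset_closedBall` (a separated subset of a compact ball is finite);
the count is the volume packing bound `card_le_of_separated_of_dist_le` of the tree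
(`#(S ∩ B̄_r(c)) ≤ (2r/δ + 1)³`, disjoint balls of radius `δ/2` inside `B(c, r + δ/2)`), and
`(2r/δ + 1)³ ≤ (2/δ + 1)³ (1 + r)³` for `r ≥ 0`, so `C₀ := (2/δ + 1)³`.

Registered signature: `Cruxes/FiveFoldRation/Lines/Sketch.lean` (v4), `let`-abbreviated style
where applicable.
-/

noncomputable section

namespace Summit.AtomisticToContinuum.Crystallization.Theorems

open Literature.MathematicalPhysics.StatisticalMechanics

/-- Packing count in a closed ball of a separated set: for a `δ`-separated `S ⊆ ℝ³` (`δ > 0`),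
`S ∩ B̄_r(c)` is finite and `#(S ∩ B̄_r(c)) ≤ (2r/δ + 1)³` for `r ≥ 0` (the tree's
`finite_of_forall_le_dist_of_subset_closedBall` and `card_le_of_separated_of_dist_le`).
[folklore] -/
theorem dr5cu_ncard_inter_closedBall_le {δ : ℝ} (hδ : 0 < δ) {S : Set (EuclideanSpace ℝ (Fin 3))}
    (hsep : ∀ y ∈ S, ∀ z ∈ S, y ≠ z → δ ≤ dist y z) (c : EuclideanSpace ℝ (Fin 3)) {r : ℝ}
    (hr : 0 ≤ r) :
    (S ∩ Metric.closedBall c r).Finite ∧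
      ((S ∩ Metric.closedBall c r).ncard : ℝ) ≤ (2 * r / δ + 1) ^ 3 := by
  -- adapted from `HullBulkOptimal.ncard_ball_le` (HullExactificationCascadeHullBulkOptimalCut)
  have hF : (S ∩ Metric.closedBall c r).Finite :=
    finite_of_forall_le_dist_of_subset_closedBall hδ
      (fun p hp q hq hpq => hsep p hp.1 q hq.1 hpq) Set.inter_subset_right
  refine ⟨hF, ?_⟩
  rw [Set.ncard_eq_toFinset_card _ hF]
  have h := card_le_of_separated_of_dist_le hF.toFinset c hδ hr
    (fun p hp => Metric.mem_closedBall.1 ((Set.Finite.mem_toFinset hF).1 hp).2)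
    (fun p hp q hq hpq => hsep p ((Set.Finite.mem_toFinset hF).1 hp).1 q
      ((Set.Finite.mem_toFinset hF).1 hq).1 hpq)
  rwa [finrank_euclideanSpace_fin] at h

/-- A `δ`-separated `S ⊆ ℝ³` meets every closed ball in a finite set of at most `C₀ (1 + r)³` points, `C₀` depending on `δ` only. -/
theorem stub_dr5_cubic : ∀ δ : ℝ, 0 < δ → ∀ S : Set (EuclideanSpace ℝ (Fin 3)), (∀ y ∈ S, ∀ z ∈ S, y ≠ z → δ ≤ dist y z) → (∀ c : EuclideanSpace ℝ (Fin 3), ∀ r : ℝ, (S ∩ Metric.closedBall c r).Finite) ∧ ∃ C₀ : ℝ, ∀ c : EuclideanSpace ℝ (Fin 3), ∀ r : ℝ, 0 ≤ r → ((S ∩ Metric.closedBall c r).ncard : ℝ) ≤ C₀ * (1 + r) ^ 3 := by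
  intro δ hδ S hsep
  -- finiteness for every radius (a negative radius gives the empty ball)
  have hfin : ∀ c : EuclideanSpace ℝ (Fin 3), ∀ r : ℝ, (S ∩ Metric.closedBall c r).Finite :=
    fun c r => finite_of_forall_le_dist_of_subset_closedBall hδ
      (fun p hp q hq hpq => hsep p hp.1 q hq.1 hpq) Set.inter_subset_right
  refine ⟨hfin, (2 / δ + 1) ^ 3, fun c r hr => ?_⟩
  have h := (dr5cu_ncard_inter_closedBall_le hδ hsep c hr).2
  -- `(2r/δ + 1)³ ≤ (2/δ + 1)³ (1 + r)³`
  have hδ' : 0 < δ⁻¹ := inv_pos.2 hδ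
  have h1 : 2 * r / δ + 1 ≤ (2 / δ + 1) * (1 + r) := by
    rw [div_eq_mul_inv, div_eq_mul_inv]
    nlinarith
  have h0 : 0 ≤ 2 * r / δ + 1 := by positivity
  calc ((S ∩ Metric.closedBall c r).ncard : ℝ) ≤ (2 * r / δ + 1) ^ 3 := h
    _ ≤ ((2 / δ + 1) * (1 + r)) ^ 3 := pow_le_pow_left₀ h0 h1 3
    _ = (2 / δ + 1) ^ 3 * (1 + r) ^ 3 := by ring

end Summit.AtomisticToContinuum.Crystallization.Theorems

end
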